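import Mathlib
import Summits.Ventures.PercRepro2.OneEdge
import Summits.Ventures.PercRepro2.KPrimeReduction
import Summits.Ventures.PercRepro2.KPrimeBase
import Summits.Ventures.PercRepro2.KPrimeSure
import Summits.Ventures.PercRepro2.KPrimeEdgeSteps
import Summits.Ventures.PercRepro2.KPrimeVEdge
import Summits.Ventures.PercRepro2.KPrimeVYDict
import Summits.Ventures.PercRepro2.KPrimeVYEdge
import Summits.Ventures.PercRepro2.KPrimeVBEdge

/-!
# The general `v`-root edge of the `v`-exploration of `(K′)`: the exact cleared mixture identity,
and the step modulo the THRESHOLD ROOM of world `1`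
(blind cell PercRepro2, mine-c g35; `conjectures/MINE-C.md` §44.3)

For an unresolved edge `e = {x, z}` from the weight-`1` root of `v` to ANY vertex `z` (free, or
`y`, or `b`), with `S⁰ = P⁰(S)`, `S¹ = P¹(S)`, `t = p e`, `(N₀, D₀)` the parent's threshold pair,
the cleared form satisfies EXACTLY (`vfree_form_nonneg` carries the identity)

  `S⁰·S¹·form(p) = (1 − t)·P(S)·S¹·G⁰ + t·P(S)·S⁰·G¹ + t(1 − t)·PA·(G⁰_z + D₀·S⁰·B̂_z)`

with `G⁰ = form(p⁰; N₀, D₀)` (`≥ 0` from `(K′)(p⁰)`: threshold lemma + `lean_drop_ineq`),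
`G⁰_z = form(p⁰; y := z; N₀, D₀)` (`≥ 0` from `(K′)(p⁰; y := z)` likewise),
`PA = S¹·P⁰(Y ∩ S) − S⁰·P¹(Y ∩ S) = S⁰·P⁰(y, z ∈ C₂, S) − P⁰(z ∈ C₂, S)·P⁰(Y ∩ S) ≥ 0` (van den
Berg–Kahn for `a₂`), `B̂_z = P⁰(U ∩ Ω ∩ {a₂ ↮ z} ∩ Xᶜ ∩ {b ↔ z}) ≥ 0`, and

  `G¹ = form(p¹; N₀, D₀)` — THE WORLD-`1` FORM AT THE PARENT'S THRESHOLD,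

the one unsigned piece.  **Theorem** (`kprimeHolds_of_update_zero_vfree`):
`(K′)(p⁰) → (K′)(p⁰; y := z) → 0 ≤ G¹ → (K′)(p)`.  The hypothesis `0 ≤ G¹` («world `1` has the
threshold room `E₀(p) − E₀(p¹)`») is NOT a theorem — it fails on `3 / 2,235` random instances
(`MINE-C.md` §44.3) — but it isolates the open content of the lane exactly: at a free edge the
step holds as soon as the room deficit of world `1` is paid by the world-`0` gain and the PA term.
The cases `z = y` (`G¹ = 0`) and `z = b` (`G¹ = (D₀ − N₀)·Q¹ ≥ 0`) are the theorems of
`KPrimeVYEdge.lean` / `KPrimeVBEdge.lean`.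
-/

namespace Summit.Ventures.PercRepro2

namespace KPrime

variable {V : Type*} {E : Type*} [Fintype E] [DecidableEq E] [Fintype V] [DecidableEq V]
  {R : Type*} [Field R] [LinearOrder R] [IsStrictOrderedRing R]

section VFreeAlgebra

omit [Fintype E] [DecidableEq E] [Fintype V] [DecidableEq V] in
/-- The algebra of the general `v`-root edge step, modulo the room `0 ≤ G¹`.  Dictionary:
`S¹ = Sm − YSz`, `H¹ = H − Dz + O1z`, `A¹ = A − Cz + Bhz + O1ez`, `YS¹ = Ys − YSZc`; the other
world-`1` masses `Oe1, O11, C1, D1, n1, d1` are free atoms.  The identity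
`Sm·S¹·form = (1 − t)·Sm(p)·S¹·G⁰ + t·Sm(p)·Sm·G¹ + t(1 − t)·PA·(G⁰_z + D₀·Sm·B̂_z)` is by `ring`;
the degenerate cases `Sm = 0` (form `= 0`) and `S¹ = 0` (form `= (1 − t)²·G⁰`) are separate. -/
lemma vfree_form_nonneg {t A H Ys Sm Oe O C D n0 d0 YSz O1ez O1z Cz Dz Bhz YSZc n1 d1 O11 Oe1
    C1 D1 : R}
    (ht0 : 0 ≤ t) (ht1 : t ≤ 1) (hSm : 0 ≤ Sm) (hYs : 0 ≤ Ys) (hYSz : 0 ≤ YSz) (hO : 0 ≤ O)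
    (hO1z : 0 ≤ O1z) (hBhz : 0 ≤ Bhz) (hYSZc : 0 ≤ YSZc) (hd0 : 0 ≤ d0) (hd1 : 0 ≤ d1)
    (hn0 : 0 ≤ n0) (hn1 : 0 ≤ n1) (hd1d0 : d1 ≤ d0) (hn1d1 : n1 ≤ d1) (hn0d0 : n0 ≤ d0)
    (hI1 : n1 * d0 ≤ n0 * d1) (hS1 : 0 ≤ Sm - YSz) (hYs_le : Ys ≤ Sm) (hYS1 : 0 ≤ Ys - YSZc)
    (hβ : D * Sm ≤ H * Ys) (hβz : Dz * Sm ≤ H * YSz) (hPA : YSz * Ys ≤ Sm * YSZc)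
    (h0 : 0 ≤ (A * d0 - n0 * H) * Ys + Sm * ((Oe * d0 - n0 * O) - (C * d0 - n0 * D)))
    (h0z : 0 ≤ (A * d0 - n0 * H) * YSz + Sm * ((O1ez * d0 - n0 * O1z) - (Cz * d0 - n0 * Dz)))
    (h1 : 0 ≤ (((A - Cz + Bhz + O1ez) * (t * d1 + (1 - t) * d0) - (t * n1 + (1 - t) * n0) * (H - Dz + O1z)) * (Ys - YSZc) + (Sm - YSz) * ((Oe1 * (t * d1 + (1 - t) * d0) - (t * n1 + (1 - t) * n0) * O11) - (C1 * (t * d1 + (1 - t) * d0) - (t * n1 + (1 - t) * n0) * D1))))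
    (hYS1_le : Ys - YSZc ≤ Sm - YSz) (hH1_le : H - Dz + O1z ≤ Sm - YSz)
    (hA1_le : A - Cz + Bhz + O1ez ≤ Sm - YSz) (hOe1_le : Oe1 ≤ Sm - YSz)
    (hO11_le : O11 ≤ Sm - YSz) (hC1_le : C1 ≤ Sm - YSz) (hD1_le : D1 ≤ Sm - YSz)
    (hA1 : 0 ≤ A - Cz + Bhz + O1ez) (hH1 : 0 ≤ H - Dz + O1z) (hOe1 : 0 ≤ Oe1) (hO11 : 0 ≤ O11)
    (hC1 : 0 ≤ C1) (hD1 : 0 ≤ D1) :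
    0 ≤ (((t * (A - Cz + Bhz + O1ez) + (1 - t) * A) * (t * d1 + (1 - t) * d0) - (t * n1 + (1 - t) * n0) * (t * (H - Dz + O1z) + (1 - t) * H)) * (t * (Ys - YSZc) + (1 - t) * Ys) + (t * (Sm - YSz) + (1 - t) * Sm) * (((t * Oe1 + (1 - t) * Oe) * (t * d1 + (1 - t) * d0) - (t * n1 + (1 - t) * n0) * (t * O11 + (1 - t) * O)) - ((t * C1 + (1 - t) * C) * (t * d1 + (1 - t) * d0) - (t * n1 + (1 - t) * n0) * (t * D1 + (1 - t) * D)))) := by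
  have h1t : 0 ≤ 1 - t := sub_nonneg.2 ht1
  have hβ' : 0 ≤ H * Ys + Sm * (O - D) := by linarith [mul_nonneg hSm hO]
  have hβz' : 0 ≤ H * YSz + Sm * (O1z - Dz) := by linarith [mul_nonneg hSm hO1z]
  have hD₀ : 0 ≤ t * d1 + (1 - t) * d0 := add_nonneg (mul_nonneg ht0 hd1) (mul_nonneg h1t hd0)
  have hN₀ : 0 ≤ t * n1 + (1 - t) * n0 := add_nonneg (mul_nonneg ht0 hn1) (mul_nonneg h1t hn0)
  have hDle : t * d1 + (1 - t) * d0 ≤ d0 := by linarith [mul_nonneg ht0 (sub_nonneg.2 hd1d0)]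
  have hNle : t * n1 + (1 - t) * n0 ≤ t * d1 + (1 - t) * d0 := by
    linarith [mul_nonneg ht0 (sub_nonneg.2 hn1d1), mul_nonneg h1t (sub_nonneg.2 hn0d0)]
  have hND : (t * n1 + (1 - t) * n0) * d0 ≤ n0 * (t * d1 + (1 - t) * d0) := by
    linarith [mul_nonneg ht0 (sub_nonneg.2 hI1)]
  have hG0 : 0 ≤ ((t * d1 + (1 - t) * d0) * (A * Ys + Sm * (Oe - C)) - (t * n1 + (1 - t) * n0) * (H * Ys + Sm * (O - D))) :=
    thr_nonneg hβ' hd0 hN₀ hDle hNle hND (by linarith [h0])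
  have hGz0 : 0 ≤ ((t * d1 + (1 - t) * d0) * (A * YSz + Sm * (O1ez - Cz)) - (t * n1 + (1 - t) * n0) * (H * YSz + Sm * (O1z - Dz))) :=
    thr_nonneg hβz' hd0 hN₀ hDle hNle hND (by linarith [h0z])
  have hPA' : 0 ≤ ((Sm - YSz) * Ys - Sm * (Ys - YSZc)) := by linarith
  have hSmp : 0 ≤ (t * (Sm - YSz) + (1 - t) * Sm) := add_nonneg (mul_nonneg ht0 hS1) (mul_nonneg h1t hSm)
  rcases hSm.eq_or_lt with hSm0 | hSmpos
  · -- `Sm = 0`: every `S`-mass is `0` and the form is `0`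
    have e1 : YSz = 0 := by linarith
    have e2 : Ys = 0 := by linarith
    have e3 : YSZc = 0 := by linarith
    rw [← hSm0, e1, e2, e3]; linarith
  rcases hS1.eq_or_lt with hS10 | hS1pos
  · -- `S¹ = 0`: the world-`1` `S`-masses vanish and the form is `(1 − t)² · G⁰`
    have e1 : YSz = Sm := by linarith
    have e2 : YSZc = Ys := by linarith
    have e3 : O1z = Dz - H := by linarith
    have e4 : Bhz = Cz - A - O1ez := by linarith
    have e5 : Oe1 = 0 := by linarith
    have e6 : O11 = 0 := by linarith
    have e7 : C1 = 0 := by linarith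
    have e8 : D1 = 0 := by linarith
    rw [e1, e2, e3, e4, e5, e6, e7, e8]
    linarith [mul_nonneg (mul_nonneg h1t h1t) hG0]
  · have key : Sm * (Sm - YSz) * (((t * (A - Cz + Bhz + O1ez) + (1 - t) * A) * (t * d1 + (1 - t) * d0) - (t * n1 + (1 - t) * n0) * (t * (H - Dz + O1z) + (1 - t) * H)) * (t * (Ys - YSZc) + (1 - t) * Ys) + (t * (Sm - YSz) + (1 - t) * Sm) * (((t * Oe1 + (1 - t) * Oe) * (t * d1 + (1 - t) * d0) - (t * n1 + (1 - t) * n0) * (t * O11 + (1 - t) * O)) - ((t * C1 + (1 - t) * C) * (t * d1 + (1 - t) * d0) - (t * n1 + (1 - t) * n0) * (t * D1 + (1 - t) * D)))) = (1 - t) * (t * (Sm - YSz) + (1 - t) * Sm) * (Sm - YSz) * ((t * d1 + (1 - t) * d0) * (A * Ys + Sm * (Oe - C)) - (t * n1 + (1 - t) * n0) * (H * Ys + Sm * (O - D))) + t * (t * (Sm - YSz) + (1 - t) * Sm) * Sm * (((A - Cz + Bhz + O1ez) * (t * d1 + (1 - t) * d0) - (t * n1 + (1 - t) * n0) * (H -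 Dz + O1z)) * (Ys - YSZc) + (Sm - YSz) * ((Oe1 * (t * d1 + (1 - t) * d0) - (t * n1 + (1 - t) * n0) * O11) - (C1 * (t * d1 + (1 - t) * d0) - (t * n1 + (1 - t) * n0) * D1))) + t * (1 - t) * ((Sm - YSz) * Ys - Sm * (Ys - YSZc)) * (((t * d1 + (1 - t) * d0) * (A * YSz + Sm * (O1ez - Cz)) - (t * n1 + (1 - t) * n0) * (H * YSz + Sm * (O1z - Dz))) + (t * d1 + (1 - t) * d0) * Sm * Bhz) := by ring
    have hR : 0 ≤ (1 - t) * (t * (Sm - YSz) + (1 - t) * Sm) * (Sm - YSz) * ((t * d1 + (1 - t) * d0) * (A * Ys + Sm * (Oe - C)) - (t * n1 + (1 - t) * n0) * (H * Ys + Sm * (O - D))) + t * (t * (Sm - YSz) + (1 - t) * Sm) * Sm * (((A - Cz + Bhz + O1ez) * (t * d1 + (1 - t) * d0) - (t * n1 + (1 - t) * n0) * (H - Dz + O1z)) * (Ys - YSZc) + (Sm - YSz) * ((Oe1 * (t * d1 + (1 - t) * d0) - (t * n1 + (1 - t) * n0) * O11) - (C1 * (t * d1 + (1 - t) * d0) -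 (t * n1 + (1 - t) * n0) * D1))) + t * (1 - t) * ((Sm - YSz) * Ys - Sm * (Ys - YSZc)) * (((t * d1 + (1 - t) * d0) * (A * YSz + Sm * (O1ez - Cz)) - (t * n1 + (1 - t) * n0) * (H * YSz + Sm * (O1z - Dz))) + (t * d1 + (1 - t) * d0) * Sm * Bhz) := by
      refine add_nonneg (add_nonneg ?_ ?_) ?_
      · exact mul_nonneg (mul_nonneg (mul_nonneg h1t hSmp) hS1) hG0
      · exact mul_nonneg (mul_nonneg (mul_nonneg ht0 hSmp) hSm) h1
      · exact mul_nonneg (mul_nonneg (mul_nonneg ht0 h1t) hPA')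
          (add_nonneg hGz0 (mul_nonneg (mul_nonneg hD₀ hSm) hBhz))
    rw [← key] at hR
    have h2 := (mul_nonneg_iff_of_pos_left hSmpos).1 ((mul_assoc Sm (Sm - YSz) _).symm ▸ hR)
    exact (mul_nonneg_iff_of_pos_left hS1pos).1 h2

end VFreeAlgebra

section StepVFree

variable {ends : E → Sym2 V} {a₁ a₂ b v y : V} {p : E → R} {e : E}

/-- **Resolving a `v`-root edge into any vertex `z`, modulo the threshold room of world `1`**:
`(K′)` for the world `e` closed with the marks `y` and `z`, and the world-`1` form at the PARENT's
threshold `≥ 0`, give `(K′)`. -/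
theorem kprimeHolds_of_update_zero_vfree (hp : IsProbVec p) {x z : V} (hends : ends e = s(x, z))
    (hx : x ∈ root p ends v) (he : p e ≠ 1)
    (h0 : KPrimeHolds ends a₁ a₂ b v y (Function.update p e 0))
    (h0z : KPrimeHolds ends a₁ a₂ b v z (Function.update p e 0))
    (h1 : 0 ≤ kprimeForm ends a₁ a₂ b v y (Function.update p e 1)
      (prob p (connEvent ends a₁ b ∩ N ends a₁ a₂ v)) (prob p (N ends a₁ a₂ v))) :
    KPrimeHolds ends a₁ a₂ b v y p := by
  have hp0 : IsProbVec (Function.update p e 0) := hp.update e le_rfl zero_le_one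
  have hp1 : IsProbVec (Function.update p e 1) := hp.update e zero_le_one le_rfl
  -- the dictionary (`KPrimeVYDict` with `y := z`, `prob_YS_vb` with `b := z`)
  have hS1 := prob_S_vy (a₁ := a₁) (a₂ := a₂) (y := z) hends hx he
  have hN1 := prob_N_vy (a₁ := a₁) (a₂ := a₂) (y := z) hends hx he
  have hXN1 := prob_XN_vy (a₁ := a₁) (a₂ := a₂) (b := b) (y := z) hends hx he
  have hH1 := prob_UΩ_vy (a₁ := a₁) (a₂ := a₂) (y := z) hends hx he
  have hA1 := prob_UXΩ_vy (a₁ := a₁) (a₂ := a₂) (b := b) (y := z) hends hx he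
  have hYS1 := prob_YS_vb (a₁ := a₁) (a₂ := a₂) (b := z) (y := y) hends hx he
  -- world `0`: decompositions along `{a₂ ↔ z}`
  have eS := prob_inter_add_prob_inter_compl (Function.update p e 0) (S ends a₁ a₂ v)
    (connEvent ends a₂ z)
  have eH := prob_inter_add_prob_inter_compl (Function.update p e 0)
    (connEvent ends a₁ v ∩ Ω ends a₁ a₂) (connEvent ends a₂ z)
  have eA := prob_inter_add_prob_inter_compl (Function.update p e 0)
    (connEvent ends a₁ v ∩ connEvent ends a₁ b ∩ Ω ends a₁ a₂) (connEvent ends a₂ z)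
  have eY := prob_inter_add_prob_inter_compl (Function.update p e 0)
    (connEvent ends a₂ y ∩ S ends a₁ a₂ v) (connEvent ends a₂ z)
  have kS : S ends a₁ a₂ v ∩ connEvent ends a₂ z = connEvent ends a₂ z ∩ S ends a₁ a₂ v :=
    Set.inter_comm _ _
  have kH : connEvent ends a₁ v ∩ Ω ends a₁ a₂ ∩ connEvent ends a₂ z =
      connEvent ends a₁ v ∩ connEvent ends a₂ z ∩ Ω ends a₁ a₂ := by
    ext ω; simp only [Set.mem_inter_iff]; tauto
  have kA : connEvent ends a₁ v ∩ connEvent ends a₁ b ∩ Ω ends a₁ a₂ ∩ connEvent ends a₂ z =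
      connEvent ends a₁ v ∩ connEvent ends a₂ z ∩ connEvent ends a₁ b ∩ Ω ends a₁ a₂ := by
    ext ω; simp only [Set.mem_inter_iff]; tauto
  rw [kS] at eS
  rw [kH] at eH
  rw [kA] at eA
  -- the world-`1` bounds, in world-`1` terms
  have hYS1_le : prob (Function.update p e 1) (connEvent ends a₂ y ∩ S ends a₁ a₂ v) ≤
      prob (Function.update p e 1) (S ends a₁ a₂ v) := prob_mono hp1 Set.inter_subset_right
  have hH1_le : prob (Function.update p e 1) (connEvent ends a₁ v ∩ Ω ends a₁ a₂) ≤
      prob (Function.update p e 1) (S ends a₁ a₂ v) := by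
    rw [U_inter_Ω_eq]; exact prob_mono hp1 Set.inter_subset_right
  have hUΩS : ∀ ω, ω ∈ connEvent ends a₁ v ∩ Ω ends a₁ a₂ → ω ∈ S ends a₁ a₂ v := fun ω hω =>
    ((Set.ext_iff.1 U_inter_Ω_eq ω).1 hω).2
  have hA1_le : prob (Function.update p e 1)
      (connEvent ends a₁ v ∩ connEvent ends a₁ b ∩ Ω ends a₁ a₂) ≤
      prob (Function.update p e 1) (S ends a₁ a₂ v) :=
    prob_mono hp1 fun ω hω => hUΩS ω ⟨hω.1.1, hω.2⟩
  have hOe1_le : prob (Function.update p e 1) (cls01e ends a₁ a₂ b v y) ≤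
      prob (Function.update p e 1) (S ends a₁ a₂ v) := prob_mono hp1 cls01e_subset_S
  have hO11_le : prob (Function.update p e 1) (cls01 ends a₁ a₂ v y) ≤
      prob (Function.update p e 1) (S ends a₁ a₂ v) := prob_mono hp1 cls01_subset_S
  have hC1_le : prob (Function.update p e 1)
      (connEvent ends a₁ v ∩ connEvent ends a₂ y ∩ connEvent ends a₁ b ∩ Ω ends a₁ a₂) ≤
      prob (Function.update p e 1) (S ends a₁ a₂ v) :=
    prob_mono hp1 fun ω hω => hUΩS ω ⟨hω.1.1.1, hω.2⟩
  have hD1_le : prob (Function.update p e 1)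
      (connEvent ends a₁ v ∩ connEvent ends a₂ y ∩ Ω ends a₁ a₂) ≤
      prob (Function.update p e 1) (S ends a₁ a₂ v) :=
    prob_mono hp1 fun ω hω => hUΩS ω ⟨hω.1.1, hω.2⟩
  have hA1n := prob_nonneg hp1 (connEvent ends a₁ v ∩ connEvent ends a₁ b ∩ Ω ends a₁ a₂)
  have hH1n := prob_nonneg hp1 (connEvent ends a₁ v ∩ Ω ends a₁ a₂)
  have hOe1 := prob_nonneg hp1 (cls01e ends a₁ a₂ b v y)
  have hO11 := prob_nonneg hp1 (cls01 ends a₁ a₂ v y)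
  have hC1 := prob_nonneg hp1
    (connEvent ends a₁ v ∩ connEvent ends a₂ y ∩ connEvent ends a₁ b ∩ Ω ends a₁ a₂)
  have hD1 := prob_nonneg hp1 (connEvent ends a₁ v ∩ connEvent ends a₂ y ∩ Ω ends a₁ a₂)
  rw [hS1, hYS1] at hYS1_le
  rw [hS1, hH1] at hH1_le
  rw [hS1, hA1] at hA1_le
  rw [hS1] at hOe1_le hO11_le hC1_le hD1_le
  rw [hA1] at hA1n
  rw [hH1] at hH1n
  -- the world-`0` inequalities
  have hI1 := lean_drop_ineq (ends := ends) (a₁ := a₁) (a₂ := a₂) (b := b) (v := v) (y := z) hp0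
  have hβ := slope_ineq (Function.update p e 0) ends a₁ a₂ v y hp0
  have hβz := slope_ineq (Function.update p e 0) ends a₁ a₂ v z hp0
  have hPA := pa_ineq_vb (ends := ends) (a₁ := a₁) (a₂ := a₂) (b := z) (v := v) (y := y) hp0
  have hd1d0 : prob (Function.update p e 0) (N ends a₁ a₂ v ∩ (connEvent ends a₁ z)ᶜ) ≤
      prob (Function.update p e 0) (N ends a₁ a₂ v) := prob_mono hp0 Set.inter_subset_left
  have hn1d1 : prob (Function.update p e 0)
      (connEvent ends a₁ b ∩ N ends a₁ a₂ v ∩ (connEvent ends a₁ z)ᶜ) ≤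
      prob (Function.update p e 0) (N ends a₁ a₂ v ∩ (connEvent ends a₁ z)ᶜ) :=
    prob_mono hp0 (Set.inter_subset_inter_left _ Set.inter_subset_right)
  have hn0d0 : prob (Function.update p e 0) (connEvent ends a₁ b ∩ N ends a₁ a₂ v) ≤
      prob (Function.update p e 0) (N ends a₁ a₂ v) := prob_mono hp0 Set.inter_subset_right
  have hYs_le : prob (Function.update p e 0) (connEvent ends a₂ y ∩ S ends a₁ a₂ v) ≤
      prob (Function.update p e 0) (S ends a₁ a₂ v) := prob_mono hp0 Set.inter_subset_right
  -- expand the forms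
  unfold KPrimeHolds kprimeForm at h0 h0z ⊢
  unfold kprimeForm at h1
  rw [prob_eq_pin p (connEvent ends a₁ v ∩ connEvent ends a₁ b ∩ Ω ends a₁ a₂) e,
    prob_eq_pin p (connEvent ends a₁ b ∩ N ends a₁ a₂ v) e,
    prob_eq_pin p (N ends a₁ a₂ v) e,
    prob_eq_pin p (connEvent ends a₁ v ∩ Ω ends a₁ a₂) e,
    prob_eq_pin p (connEvent ends a₂ y ∩ S ends a₁ a₂ v) e,
    prob_eq_pin p (S ends a₁ a₂ v) e,
    prob_eq_pin p (cls01e ends a₁ a₂ b v y) e,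
    prob_eq_pin p (cls01 ends a₁ a₂ v y) e,
    prob_eq_pin p (connEvent ends a₁ v ∩ connEvent ends a₂ y ∩ connEvent ends a₁ b ∩ Ω ends a₁ a₂) e,
    prob_eq_pin p (connEvent ends a₁ v ∩ connEvent ends a₂ y ∩ Ω ends a₁ a₂) e]
  rw [prob_eq_pin p (connEvent ends a₁ b ∩ N ends a₁ a₂ v) e, prob_eq_pin p (N ends a₁ a₂ v) e] at h1
  rw [hS1, hN1, hXN1, hH1, hA1, hYS1]
  rw [hS1, hN1, hXN1, hH1, hA1, hYS1] at h1
  have eSc : prob (Function.update p e 0) (S ends a₁ a₂ v ∩ (connEvent ends a₂ z)ᶜ) =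
      prob (Function.update p e 0) (S ends a₁ a₂ v) -
        prob (Function.update p e 0) (connEvent ends a₂ z ∩ S ends a₁ a₂ v) := by linarith
  have eHc : prob (Function.update p e 0)
      (connEvent ends a₁ v ∩ Ω ends a₁ a₂ ∩ (connEvent ends a₂ z)ᶜ) =
      prob (Function.update p e 0) (connEvent ends a₁ v ∩ Ω ends a₁ a₂) -
        prob (Function.update p e 0) (connEvent ends a₁ v ∩ connEvent ends a₂ z ∩ Ω ends a₁ a₂) := by
    linarith
  have eAc : prob (Function.update p e 0)
      (connEvent ends a₁ v ∩ connEvent ends a₁ b ∩ Ω ends a₁ a₂ ∩ (connEvent ends a₂ z)ᶜ) =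
      prob (Function.update p e 0) (connEvent ends a₁ v ∩ connEvent ends a₁ b ∩ Ω ends a₁ a₂) -
        prob (Function.update p e 0)
          (connEvent ends a₁ v ∩ connEvent ends a₂ z ∩ connEvent ends a₁ b ∩ Ω ends a₁ a₂) := by
    linarith
  have eYc : prob (Function.update p e 0)
      (connEvent ends a₂ y ∩ S ends a₁ a₂ v ∩ (connEvent ends a₂ z)ᶜ) =
      prob (Function.update p e 0) (connEvent ends a₂ y ∩ S ends a₁ a₂ v) -
        prob (Function.update p e 0)
          (connEvent ends a₂ y ∩ S ends a₁ a₂ v ∩ connEvent ends a₂ z) := by linarith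
  rw [eSc, eHc, eAc, eYc]
  rw [eSc, eHc, eAc, eYc] at h1
  rw [eSc, eYc] at hYS1_le
  rw [eSc, eHc] at hH1_le
  rw [eSc, eAc] at hA1_le
  rw [eSc] at hOe1_le hO11_le hC1_le hD1_le
  rw [eAc] at hA1n
  rw [eHc] at hH1n
  have hS1n : 0 ≤ prob (Function.update p e 0) (S ends a₁ a₂ v) -
      prob (Function.update p e 0) (connEvent ends a₂ z ∩ S ends a₁ a₂ v) := by
    have := prob_nonneg hp0 (S ends a₁ a₂ v ∩ (connEvent ends a₂ z)ᶜ)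
    linarith
  have hYS1n : 0 ≤ prob (Function.update p e 0) (connEvent ends a₂ y ∩ S ends a₁ a₂ v) -
      prob (Function.update p e 0)
        (connEvent ends a₂ y ∩ S ends a₁ a₂ v ∩ connEvent ends a₂ z) := by
    have := prob_nonneg hp0 (connEvent ends a₂ y ∩ S ends a₁ a₂ v ∩ (connEvent ends a₂ z)ᶜ)
    linarith
  have key := vfree_form_nonneg (hp.nonneg e) (hp.le_one e)
    (prob_nonneg hp0 (S ends a₁ a₂ v))
    (prob_nonneg hp0 (connEvent ends a₂ y ∩ S ends a₁ a₂ v))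
    (prob_nonneg hp0 (connEvent ends a₂ z ∩ S ends a₁ a₂ v))
    (prob_nonneg hp0 (cls01 ends a₁ a₂ v y))
    (prob_nonneg hp0 (cls01 ends a₁ a₂ v z))
    (prob_nonneg hp0 (connEvent ends a₁ v ∩ Ω ends a₁ a₂ ∩ (connEvent ends a₂ z)ᶜ ∩
      (connEvent ends a₁ b)ᶜ ∩ connEvent ends b z))
    (prob_nonneg hp0 (connEvent ends a₂ y ∩ S ends a₁ a₂ v ∩ connEvent ends a₂ z))
    (prob_nonneg hp0 (N ends a₁ a₂ v))
    (prob_nonneg hp0 (N ends a₁ a₂ v ∩ (connEvent ends a₁ z)ᶜ))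
    (prob_nonneg hp0 (connEvent ends a₁ b ∩ N ends a₁ a₂ v))
    (prob_nonneg hp0 (connEvent ends a₁ b ∩ N ends a₁ a₂ v ∩ (connEvent ends a₁ z)ᶜ))
    hd1d0 hn1d1 hn0d0 hI1 hS1n hYs_le hYS1n hβ hβz (by linarith [hPA]) h0 h0z h1
    hYS1_le hH1_le hA1_le hOe1_le hO11_le hC1_le hD1_le hA1n hH1n hOe1 hO11 hC1 hD1
  linarith [key]

end StepVFree


end KPrime

end Summit.Ventures.PercRepro2
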